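import Literature.Geometry.Kaehler.ManifoldFormsFunSmulProofs
import Literature.NumberTheory.Transcendental.ComplexFormsSmoothProofs
import Literature.NumberTheory.Transcendental.ComplexFormsProofs
import Literature.NumberTheory.Transcendental.Dolbeault
import Literature.Analysis.Complex.PQOperators
import Literature.Geometry.Kaehler.Kaehler

/-!
# The Leibniz rule for `∂`: `∂(ρδ) = ρ ∂δ + ∂ρ ∧ δ`

On a complex manifold `M` (holomorphic atlas), for a real function `ρ` differentiable at `x` and a
smooth complex `k`-form `δ`:

* `dolbeault_fun_smul_apply`: `∂(ρ • δ) x = ρ x • ∂δ x + (∂ρ)ₓ ∧ δ x`, where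
  `(∂ρ)ₓ = ½ (dρₓ ⊗ 1 - i (dρₓ ∘ J) ⊗ 1)` is the `(1,0)`-part of the differential
  `dρₓ = fderivWithin ℝ (ρ ∘ e⁻¹) (range I) (e x)` read in the chart `e` at `x`, `J = tangentJ E x`
  the complex structure, and `∧ = wedgeOne` (the convention of Mathlib's `extDeriv`).

Proof: `∂ = ∑_{p+q=k} ((d (·)^{p,q})^{p+1,q}`; type components commute with real scalar functions;
`d(ρ δ^{p,q}) = ρ dδ^{p,q} + dρ ∧ δ^{p,q}` (`mextDeriv_fun_smul_apply`); `dρ = (dρ)^{1,0} + (dρ)^{0,1}`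
with `(dρ)^{1,0} ∧ δ^{p,q}` of type `(p+1,q)` and `(dρ)^{0,1} ∧ δ^{p,q}` of type `(p,q+1)`
(`IsOfTypeAt.wedgeOne_of_linear/_of_conj`), so the `(p+1,q)`-projection keeps exactly
`(dρ)^{1,0} ∧ δ^{p,q}`; summing over the antidiagonal, `∑ δ^{p,q} = δ`. Voisin (2002), §2.3.3
(definition of `∂`, `∂̄`; their Leibniz rule follows from that of `d` by taking types); Huybrechts
(2005), §2.6 (the operators `∂`, `∂̄` on `A^{p,q}` and `∂(α ∧ β) = ∂α ∧ β + (-1)^k α ∧ ∂β`), case of a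
function `ρ`.

Also recorded: the pointwise bridge `typeComponent_apply_eq_typeProjAt` between the tree's
`MForm.typeComponent` on any manifold and the flat `typeProjAt` of `Literature/Analysis/Complex/PQTypes.lean`,
and `typeComponent_fun_smul`.

## References

* C. Voisin, *Hodge Theory and Complex Algebraic Geometry I* (2002), §2.3.1, §2.3.3. [Voisin2002]
* D. Huybrechts, *Complex Geometry* (2005), §1.3, §2.6. [Huybrechts2005]
-/

noncomputable section

open scoped Manifold ContDiff Topology
open Set Finset ContinuousAlternatingMap Function Complex
open Literature.LinearAlgebra.Alternating Literature.Analysis.Complex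
open Literature.Geometry.Kaehler

namespace Literature.NumberTheory.Transcendental

variable {E : Type*} [NormedAddCommGroup E] [NormedSpace ℂ E]
  {M : Type*} [TopologicalSpace M] [ChartedSpace E M] {k : ℕ}

/-! ### Type components, pointwise -/

/-- **Pointwise bridge**: on any manifold charted on `E`, the tree's `(p,q)`-component at `x` is
the flat pointwise projection of the value: `(α^{p,q}) x = typeProjAt p q (α x)` (both are the same
finite Fourier average; the rotations `tangentRotate E x θ` do not depend on `x`). [folklore] -/
theorem typeComponent_apply_eq_typeProjAt (p q : ℕ) (α : MForm 𝓘(ℝ, E) M ℂ k) (x : M) :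
    α.typeComponent p q x = typeProjAt p q (show E [⋀^Fin k]→L[ℝ] ℂ from α x) := by
  unfold typeProjAt MForm.typeComponent MForm.weightComponent
  split_ifs <;> rfl

/-- Type components commute with multiplication by real functions:
`(ρ • α)^{p,q} = ρ • α^{p,q}`. [folklore] -/
theorem typeComponent_fun_smul (p q : ℕ) (ρ : M → ℝ) (α : MForm 𝓘(ℝ, E) M ℂ k) :
    (ρ • α).typeComponent p q = ρ • α.typeComponent p q := by
  funext x
  have h1 : (show E [⋀^Fin k]→L[ℝ] ℂ from (ρ • α) x) =
      ((ρ x : ℝ) : ℂ) • (show E [⋀^Fin k]→L[ℝ] ℂ from α x) := by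
    ext v
    exact Complex.real_smul
  rw [typeComponent_apply_eq_typeProjAt, h1, typeProjAt_smul, Pi.smul_apply',
    typeComponent_apply_eq_typeProjAt]
  ext v
  exact (Complex.real_smul).symm

/-- The value at `x` of a type component has the corresponding pointwise type. [cite: Voisin2002, §2.3.1] -/
theorem isOfTypeAt_typeComponent_apply {p q : ℕ} (h : p + q = k) (α : MForm 𝓘(ℝ, E) M ℂ k) (x : M) :
    IsOfTypeAt p q (show E [⋀^Fin k]→L[ℝ] ℂ from α.typeComponent p q x) := by
  have ht := isOfType_typeComponent_holds (E := E) (M := M) h α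
  exact ⟨h, fun θ v ↦ ht.2 x θ v⟩

/-! ### The `(1,0)`- and `(0,1)`-parts of a real covector -/

section Covector

/-- The `(1,0)`-part `a^{1,0} = ½(a ⊗ 1 - i (a ∘ J) ⊗ 1)` of a real covector is `ℂ`-linear for the
complex structure `J = i•` of `E`: `a^{1,0}(c • w) = c a^{1,0}(w)`. [cite: Voisin2002, §2.3.1] -/
theorem half_sub_I_comp_J_apply_smul (a : E →L[ℝ] ℝ) (c : ℂ) (w : E) :
    ((2⁻¹ : ℂ) • ((ofRealCLM).comp a - I • (ofRealCLM).comp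
        (a.comp ((I • ContinuousLinearMap.id ℂ E).restrictScalars ℝ)))) (c • w) =
      c * ((2⁻¹ : ℂ) • ((ofRealCLM).comp a - I • (ofRealCLM).comp
        (a.comp ((I • ContinuousLinearMap.id ℂ E).restrictScalars ℝ)))) w := by
  have hc : c • w = (c.re : ℝ) • w + (c.im : ℝ) • (I • w) := by
    conv_lhs => rw [← Complex.re_add_im c]
    rw [add_smul, ← Complex.coe_smul, mul_smul, ← Complex.coe_smul]
  simp only [_root_.smul_apply, _root_.sub_apply, ContinuousLinearMap.comp_apply, ofRealCLM_apply,
    ContinuousLinearMap.coe_restrictScalars', ContinuousLinearMap.id_apply, hc, map_add, map_smul,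
    smul_smul, Complex.I_mul_I, neg_one_smul, map_neg, smul_eq_mul]
  apply Complex.ext <;> simp

/-- The `(0,1)`-part `a^{0,1} = ½(a ⊗ 1 + i (a ∘ J) ⊗ 1)` of a real covector is conjugate-linear:
`a^{0,1}(c • w) = c̄ a^{0,1}(w)`. [cite: Voisin2002, §2.3.1] -/
theorem half_add_I_comp_J_apply_smul (a : E →L[ℝ] ℝ) (c : ℂ) (w : E) :
    ((2⁻¹ : ℂ) • ((ofRealCLM).comp a + I • (ofRealCLM).comp
        (a.comp ((I • ContinuousLinearMap.id ℂ E).restrictScalars ℝ)))) (c • w) =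
      (starRingEnd ℂ) c * ((2⁻¹ : ℂ) • ((ofRealCLM).comp a + I • (ofRealCLM).comp
        (a.comp ((I • ContinuousLinearMap.id ℂ E).restrictScalars ℝ)))) w := by
  have hc : c • w = (c.re : ℝ) • w + (c.im : ℝ) • (I • w) := by
    conv_lhs => rw [← Complex.re_add_im c]
    rw [add_smul, ← Complex.coe_smul, mul_smul, ← Complex.coe_smul]
  simp only [_root_.smul_apply, _root_.add_apply, ContinuousLinearMap.comp_apply, ofRealCLM_apply,
    ContinuousLinearMap.coe_restrictScalars', ContinuousLinearMap.id_apply, hc, map_add, map_smul,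
    smul_smul, Complex.I_mul_I, neg_one_smul, map_neg, smul_eq_mul]
  apply Complex.ext <;> simp

/-- A real covector is the sum of its `(1,0)`- and `(0,1)`-parts: `a ⊗ 1 = a^{1,0} + a^{0,1}`.
[cite: Voisin2002, §2.3.1] -/
theorem ofRealCLM_comp_eq_half_add_half (a : E →L[ℝ] ℝ) :
    (ofRealCLM).comp a =
      (2⁻¹ : ℂ) • ((ofRealCLM).comp a - I • (ofRealCLM).comp
          (a.comp ((I • ContinuousLinearMap.id ℂ E).restrictScalars ℝ))) +
        (2⁻¹ : ℂ) • ((ofRealCLM).comp a + I • (ofRealCLM).comp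
          (a.comp ((I • ContinuousLinearMap.id ℂ E).restrictScalars ℝ))) := by
  ext w
  simp only [_root_.add_apply, _root_.smul_apply, _root_.sub_apply, ContinuousLinearMap.comp_apply,
    ofRealCLM_apply, smul_eq_mul]
  ring

end Covector

/-! ### The Leibniz rule for `∂` -/

section Leibniz

variable [IsManifold 𝓘(ℂ, E) ω M] [IsManifold 𝓘(ℝ, E) ∞ M]

omit [IsManifold 𝓘(ℂ, E) ω M] [IsManifold 𝓘(ℝ, E) ∞ M] in
/-- Unfolding of `∂` at a point on a tuple: `∂α x v = ∑_{p+q=k} ((dα^{p,q})^{p+1,q}) x v`. [folklore] -/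
theorem dolbeault_apply_apply (α : MForm 𝓘(ℝ, E) M ℂ k) (x : M)
    (v : Fin (k + 1) → TangentSpace 𝓘(ℝ, E) x) :
    dolbeault α x v = ∑ pq ∈ antidiagonal k,
      (mextDeriv (α.typeComponent pq.1 pq.2)).typeComponent (pq.1 + 1) pq.2 x v := by
  rw [dolbeault, Finset.sum_apply, ContinuousAlternatingMap.sum_apply]

/-- **Leibniz rule for `∂` and a real function**: on a complex manifold, for `ρ` differentiable at
`x` and `δ` a smooth complex `k`-form,
`∂(ρ • δ) x v = ρ x • ∂δ x v + ((∂ρ)ₓ ∧ δ x) v` with `(∂ρ)ₓ = ½ (dρₓ ⊗ 1 - i (dρₓ ∘ J) ⊗ 1)` the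
`(1,0)`-part of the chart differential `dρₓ = fderivWithin ℝ (ρ ∘ e⁻¹) (range I) (e x)` and
`J = i • id` the complex structure of `T_x M = E`; `∧ = wedgeOne`. Voisin (2002), §2.3.3 (Leibniz
rule for `∂`, `∂̄` from that of `d` by taking types); Huybrechts (2005), §1.3 / §2.6.
[cite: Voisin2002, §2.3.3] -/
theorem dolbeault_fun_smul_apply {ρ : M → ℝ} {δ : MForm 𝓘(ℝ, E) M ℂ k} {x : M}
    (hρ : MDifferentiableAt 𝓘(ℝ, E) 𝓘(ℝ, ℝ) ρ x) (hδ : IsSmoothForm δ)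
    (v : Fin (k + 1) → TangentSpace 𝓘(ℝ, E) x) :
    dolbeault (ρ • δ) x v = ρ x • dolbeault δ x v +
      wedgeOne ((2⁻¹ : ℂ) • ((ofRealCLM).comp
          (fderivWithin ℝ (ρ ∘ (extChartAt 𝓘(ℝ, E) x).symm) (range 𝓘(ℝ, E)) (extChartAt 𝓘(ℝ, E) x x)) -
        I • (ofRealCLM).comp
          ((fderivWithin ℝ (ρ ∘ (extChartAt 𝓘(ℝ, E) x).symm) (range 𝓘(ℝ, E))
            (extChartAt 𝓘(ℝ, E) x x)).comp ((I • ContinuousLinearMap.id ℂ E).restrictScalars ℝ))))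
        (show E [⋀^Fin k]→L[ℝ] ℂ from δ x) v := by
  set a : E →L[ℝ] ℝ := fderivWithin ℝ (ρ ∘ (extChartAt 𝓘(ℝ, E) x).symm) (range 𝓘(ℝ, E))
    (extChartAt 𝓘(ℝ, E) x x) with ha
  set a10 : E →L[ℝ] ℂ := (2⁻¹ : ℂ) • ((ofRealCLM).comp a -
    I • (ofRealCLM).comp (a.comp ((I • ContinuousLinearMap.id ℂ E).restrictScalars ℝ))) with ha10
  set a01 : E →L[ℝ] ℂ := (2⁻¹ : ℂ) • ((ofRealCLM).comp a +
    I • (ofRealCLM).comp (a.comp ((I • ContinuousLinearMap.id ℂ E).restrictScalars ℝ))) with ha01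
  /- Step 1: per type component, as an identity of `E`-forms. -/
  have key : ∀ pq ∈ antidiagonal k,
      (show E [⋀^Fin (k + 1)]→L[ℝ] ℂ from
          (mextDeriv ((ρ • δ).typeComponent pq.1 pq.2)).typeComponent (pq.1 + 1) pq.2 x) =
        ((ρ x : ℝ) : ℂ) • (show E [⋀^Fin (k + 1)]→L[ℝ] ℂ from
            (mextDeriv (δ.typeComponent pq.1 pq.2)).typeComponent (pq.1 + 1) pq.2 x) +
          wedgeOne a10 (show E [⋀^Fin k]→L[ℝ] ℂ from δ.typeComponent pq.1 pq.2 x) := by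
    intro pq hpq
    have hpq' : pq.1 + pq.2 = k := mem_antidiagonal.1 hpq
    have hsm : (δ.typeComponent pq.1 pq.2).SmoothAt x :=
      isSmoothForm_typeComponent_holds pq.1 pq.2 hδ x
    -- `d(ρ δ^{pq}) x = ρ x • dδ^{pq} x + dρ ∧ δ^{pq} x`
    have hd : (show E [⋀^Fin (k + 1)]→L[ℝ] ℂ from mextDeriv ((ρ • δ).typeComponent pq.1 pq.2) x) =
        ((ρ x : ℝ) : ℂ) • (show E [⋀^Fin (k + 1)]→L[ℝ] ℂ from
            mextDeriv (δ.typeComponent pq.1 pq.2) x) +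
          wedgeOne ((ofRealCLM).comp a) (show E [⋀^Fin k]→L[ℝ] ℂ from δ.typeComponent pq.1 pq.2 x) := by
      rw [typeComponent_fun_smul]
      ext w
      change mextDeriv (ρ • δ.typeComponent pq.1 pq.2) x w = _
      rw [mextDeriv_fun_smul_apply hρ hsm w, ContinuousAlternatingMap.add_apply,
        ContinuousAlternatingMap.smul_apply, ← ha, Complex.real_smul, smul_eq_mul]
      congr 1
    -- types of the two halves of `dρ ∧ δ^{pq}`
    have ht : IsOfTypeAt pq.1 pq.2 (show E [⋀^Fin k]→L[ℝ] ℂ from δ.typeComponent pq.1 pq.2 x) :=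
      isOfTypeAt_typeComponent_apply hpq' δ x
    have h10 : IsOfTypeAt (pq.1 + 1) pq.2
        (wedgeOne a10 (show E [⋀^Fin k]→L[ℝ] ℂ from δ.typeComponent pq.1 pq.2 x)) :=
      ht.wedgeOne_of_linear fun c w ↦ half_sub_I_comp_J_apply_smul a c w
    have h01 : IsOfTypeAt pq.1 (pq.2 + 1)
        (wedgeOne a01 (show E [⋀^Fin k]→L[ℝ] ℂ from δ.typeComponent pq.1 pq.2 x)) :=
      ht.wedgeOne_of_conj fun c w ↦ half_add_I_comp_J_apply_smul a c w
    rw [typeComponent_apply_eq_typeProjAt, hd, typeProjAt_add, typeProjAt_smul,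
      ofRealCLM_comp_eq_half_add_half a, wedgeOne_add_left, typeProjAt_add, h10.typeProjAt_eq_self,
      h01.typeProjAt_of_ne (Or.inl (by omega)), add_zero, ← typeComponent_apply_eq_typeProjAt]
  /- Step 2: sum over the antidiagonal. -/
  have hsum : ∀ pq ∈ antidiagonal k,
      (mextDeriv ((ρ • δ).typeComponent pq.1 pq.2)).typeComponent (pq.1 + 1) pq.2 x v =
        ((ρ x : ℝ) : ℂ) * (mextDeriv (δ.typeComponent pq.1 pq.2)).typeComponent (pq.1 + 1) pq.2 x v +
          wedgeOne a10 (show E [⋀^Fin k]→L[ℝ] ℂ from δ.typeComponent pq.1 pq.2 x) v := fun pq hpq ↦ by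
    exact congrArg (fun w : E [⋀^Fin (k + 1)]→L[ℝ] ℂ ↦ w v) (key pq hpq)
  have hδsum : ∑ pq ∈ antidiagonal k, (show E [⋀^Fin k]→L[ℝ] ℂ from δ.typeComponent pq.1 pq.2 x) =
      (show E [⋀^Fin k]→L[ℝ] ℂ from δ x) := by
    have := congr_fun (sum_antidiagonal_typeComponent_holds (E := E) (M := M) δ) x
    rw [Finset.sum_apply] at this
    exact this
  rw [dolbeault_apply_apply, dolbeault_apply_apply, Finset.sum_congr rfl hsum, Finset.sum_add_distrib,
    ← Finset.mul_sum, Complex.real_smul, ← hδsum, ← wedgeOneL_apply, _root_.map_sum,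
    ContinuousAlternatingMap.sum_apply]
  simp only [wedgeOneL_apply]

end Leibniz

end Literature.NumberTheory.Transcendental
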